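import Summits.KontsevichZagierPeriods.KontsevichZagierPeriods.Theorems.SoloBlindLevelLinear
import Summits.KontsevichZagierPeriods.KontsevichZagierPeriods.Theorems.SoloBlindDuplication
import HarnessLib

/-!
# Level 6: duplication collapses `V₆` to three generators

At a composite level the `S₃`-orbits of exponent triples are in general NOT the
Deligne–Koblitz–Ogus classes. At level `6` the six orbits `{1,1,4}, {1,2,3}, {2,2,2}` (first kind)
and `{2,5,5}, {3,4,5}, {4,4,4}` (second kind) collapse to TWO classes, and inside the
Kontsevich–Zagier rules this is Legendre duplication `β(a,a) = 2·4^{-a} β(a,½)`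
(`SoloBlindDuplication`, a chain of one-dimensional moves) at `a = 1/6, 1/3, 5/6, 2/3` composed
with the orbit moves of `SoloBlindLevelLinear`:

* `levelSpan_six_le`: `V₆ = K₀ x_π + K₀ β(1/6,1/6) + K₀ β(5/6,5/6)`;
* `kz_levelSix`: if `π, B(1/6,1/6), B(5/6,5/6)` are linearly independent over `K₀` (a case of the
  Wolfart–Wüstholz theorem: the three periods lie in distinct DKO classes), the period map is
  injective on `V₆`.

This supersedes the instance `kz_level6` of `SoloBlindLevelLinear`, whose seven-term hypothesis
is false (e.g. `B(1/6,1/6) = 2^{4/3} sin(π/3) · B(1/6,1/3)`), hence vacuous; the remark there that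
the `S₃`-orbits are the DKO classes at level `6` is wrong — they are at prime level and at level
`4`.
-/

noncomputable section

open Set

namespace Summit.KontsevichZagierPeriods.KontsevichZagierPeriods.Theorems

namespace SoloBlind

open Literature.NumberTheory.Transcendental
open Literature.NumberTheory.Transcendental.KZ

/-- Duplication as a proportionality: `[β(a,a)] ≐ [β(a,½)]`. -/
theorem betaQ_propTo_dupl {a : ℚ} (ha : 0 < a) : PropTo (betaQ a a) (betaQ a (1 / 2)) :=
  ⟨duplCoeff a, duplCoeff_ne_zero a, betaQ_dupl a ha⟩

/-- The three level-6 generators `x_π, β(1/6,1/6), β(5/6,5/6)`. -/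
def sixGens : Fin 3 → Q := ![xPi, betaQ (1 / 6) (1 / 6), betaQ (5 / 6) (5 / 6)]

/-- The span of the three generators. -/
def sixSpan : Submodule K₀ Q := Submodule.span K₀ (range sixGens)

/-- `x_π ∈ ⟨sixGens⟩`. -/
theorem xPi_mem_sixSpan : xPi ∈ sixSpan := Submodule.subset_span ⟨0, rfl⟩

/-- `β(1/6,1/6) ∈ ⟨sixGens⟩`. -/
theorem beta11_mem_sixSpan : betaQ (1 / 6) (1 / 6) ∈ sixSpan := Submodule.subset_span ⟨1, rfl⟩

/-- `β(5/6,5/6) ∈ ⟨sixGens⟩`. -/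
theorem beta55_mem_sixSpan : betaQ (5 / 6) (5 / 6) ∈ sixSpan := Submodule.subset_span ⟨2, rfl⟩

/-- `β(1/6,1/2) ∈ ⟨sixGens⟩` (duplication at `1/6`). -/
theorem beta13_mem_sixSpan : betaQ (1 / 6) (1 / 2) ∈ sixSpan :=
  (betaQ_propTo_dupl (a := 1 / 6) (by norm_num)).symm.mem beta11_mem_sixSpan

/-- `β(1/6,1/3) ∈ ⟨sixGens⟩` (orbit `{1,2,3}` of `β(1/6,1/2)`). -/
theorem beta12_mem_sixSpan : betaQ (1 / 6) (1 / 3) ∈ sixSpan := by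
  have h := propTo_of_sameOrbit (N := 6) (p := (1, 3)) (q := (1, 2)) (by decide) (by decide)
    (by decide)
  norm_num at h
  exact h.mem beta13_mem_sixSpan

/-- `β(1/3,1/3) ∈ ⟨sixGens⟩` (duplication at `1/3`, then the orbit `{1,2,3}`). -/
theorem beta22_mem_sixSpan : betaQ (1 / 3) (1 / 3) ∈ sixSpan := by
  have h := propTo_of_sameOrbit (N := 6) (p := (1, 3)) (q := (2, 3)) (by decide) (by decide)
    (by decide)
  norm_num at h
  exact (betaQ_propTo_dupl (a := 1 / 3) (by norm_num)).mem (h.mem beta13_mem_sixSpan)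

/-- `β(5/6,1/2) ∈ ⟨sixGens⟩` (duplication at `5/6`). -/
theorem beta53_mem_sixSpan : betaQ (5 / 6) (1 / 2) ∈ sixSpan :=
  (betaQ_propTo_dupl (a := 5 / 6) (by norm_num)).symm.mem beta55_mem_sixSpan

/-- `β(2/3,5/6) ∈ ⟨sixGens⟩` (orbit `{3,4,5}` of `β(5/6,1/2)`). -/
theorem beta45_mem_sixSpan : betaQ (2 / 3) (5 / 6) ∈ sixSpan := by
  have h := propTo_of_sameOrbit (N := 6) (p := (5, 3)) (q := (4, 5)) (by decide) (by decide)
    (by decide)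
  norm_num at h
  exact h.mem beta53_mem_sixSpan

/-- `β(2/3,2/3) ∈ ⟨sixGens⟩` (duplication at `2/3`, then the orbit `{3,4,5}`). -/
theorem beta44_mem_sixSpan : betaQ (2 / 3) (2 / 3) ∈ sixSpan := by
  have h := propTo_of_sameOrbit (N := 6) (p := (5, 3)) (q := (4, 3)) (by decide) (by decide)
    (by decide)
  norm_num at h
  exact (betaQ_propTo_dupl (a := 2 / 3) (by norm_num)).mem (h.mem beta53_mem_sixSpan)

/-- Every generator of the orbit description of `V₆` lies in `⟨sixGens⟩`. -/
theorem levelGens_six_mem (i : Option ↥reps6) : levelGens 6 reps6 i ∈ sixSpan := by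
  rcases i with _ | ⟨⟨k, l⟩, hr⟩
  · exact xPi_mem_sixSpan
  · simp only [reps6, Finset.mem_insert, Finset.mem_singleton, Prod.mk.injEq] at hr
    simp only [levelGens]
    rcases hr with ⟨rfl, rfl⟩ | ⟨rfl, rfl⟩ | ⟨rfl, rfl⟩ | ⟨rfl, rfl⟩ | ⟨rfl, rfl⟩ | ⟨rfl, rfl⟩
    · norm_num; exact beta11_mem_sixSpan
    · norm_num; exact beta12_mem_sixSpan
    · norm_num; exact beta22_mem_sixSpan
    · norm_num; exact beta55_mem_sixSpan
    · norm_num; exact beta45_mem_sixSpan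
    · norm_num; exact beta44_mem_sixSpan

/-- **`V₆ ⊆ K₀ x_π + K₀ β(1/6,1/6) + K₀ β(5/6,5/6)`.** -/
theorem levelSpan_six_le : levelSpan 6 ≤ sixSpan := by
  rw [levelSpan_eq (by norm_num) represents6]
  exact Submodule.span_le.mpr (by rintro x ⟨i, rfl⟩; exact levelGens_six_mem i)

/-- The three generators lie in `V₆`, so `V₆` IS their span. -/
theorem levelSpan_six_eq : levelSpan 6 = sixSpan := by
  refine le_antisymm levelSpan_six_le (Submodule.span_le.mpr ?_)
  rintro x ⟨i, rfl⟩
  fin_cases i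
  · exact Submodule.subset_span (mem_insert _ _)
  · exact Submodule.subset_span (mem_insert_of_mem _ ⟨1, 1, 0, 0, le_rfl, by norm_num, le_rfl,
      by norm_num, by norm_num [sixGens]⟩)
  · exact Submodule.subset_span (mem_insert_of_mem _ ⟨5, 5, 0, 0, by norm_num, by norm_num,
      by norm_num, by norm_num, by norm_num [sixGens]⟩)

/-- The periods of the three generators: `π, Γ(1/6)²/Γ(1/3), Γ(5/6)²/Γ(5/3)`. -/
theorem evalQ_sixGens : (fun i => evalQ (sixGens i)) =
    ![Real.pi, Real.Gamma (1 / 6) * Real.Gamma (1 / 6) / Real.Gamma (1 / 3),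
      Real.Gamma (5 / 6) * Real.Gamma (5 / 6) / Real.Gamma (5 / 3)] := by
  funext i
  fin_cases i
  · exact evalQ_xPi
  · show evalQ (betaQ (1 / 6) (1 / 6)) = _
    rw [evalQ_betaQ (by norm_num) (by norm_num)]; norm_num
  · show evalQ (betaQ (5 / 6) (5 / 6)) = _
    rw [evalQ_betaQ (by norm_num) (by norm_num)]; norm_num

/-- **Level 6.** If `π, B(1/6,1/6), B(5/6,5/6)` are linearly independent over `K₀ = ℚ̄ ∩ ℝ`
(Wolfart–Wüstholz: they lie in three distinct Deligne–Koblitz–Ogus classes), then the period map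
is injective on `V₆`: every `K₀`-linear relation among the level-6 Beta words and `π` with
vanishing period follows from the three Kontsevich–Zagier rules (duplication included). -/
theorem kz_levelSix (h : LinearIndependent K₀ fun i => evalQ (sixGens i)) {z : Q}
    (hz : z ∈ levelSpan 6) (h0 : evalQ z = 0) : z = 0 := by
  obtain ⟨c, rfl⟩ := (Submodule.mem_span_range_iff_exists_fun K₀).mp (levelSpan_six_le hz)
  have hsum : ∑ i, c i • evalQ (sixGens i) = 0 := by
    rw [map_sum] at h0
    simpa only [evalQ_smul, IntermediateField.smul_def, smul_eq_mul] using h0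
  have hc : ∀ i, c i = 0 := Fintype.linearIndependent_iff.mp h c hsum
  simp [hc]

/-- The period map is injective on `V₆` (same hypothesis). -/
theorem evalQ_injOn_levelSpan_six (h : LinearIndependent K₀ fun i => evalQ (sixGens i)) :
    InjOn evalQ (levelSpan 6) := fun x hx y hy hxy => sub_eq_zero.mp
  (kz_levelSix h ((levelSpan 6).sub_mem hx hy) (by rw [map_sub, hxy, sub_self]))

end SoloBlind

end Summit.KontsevichZagierPeriods.KontsevichZagierPeriods.Theorems
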